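import Summits.Ventures.HodgeRepro2.T5SU11LegendreSoninPolya
import Summits.Ventures.HodgeRepro2.T5SU11LegendreAtZero
import Summits.Ventures.HodgeRepro2.T5SU11LegendreCentralBinomial
import Mathlib.Analysis.Real.Pi.Wallis

/-!
# Bernstein's inequality for the Legendre polynomials: `sin θ · P_n(cos θ)² ≤ 2/(πn)` (`n` even), `≤ 2/(π(n−1))` (`n` odd)

Row 459's Sonin–Pólya bound `sin θ · P_n(cos θ)² ≤ P_n(0)² + 4 P_n′(0)²/((2n+1)² + 1)` is evaluated with the
values at the origin: `P_n′(0) = −(n+1) P_{n+1}(0)` (`legQ_zero`, from `x P′_{n+1} − P′_n = (n+1) P_{n+1}` at `x = 0`),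
`P_{2m}(0) = (−1)^m a_m`, `P_{2m+1}(0) = 0` (row 417; `a_m = C(2m,m)/4^m`), and `(2m+2) a_{m+1} = (2m+1) a_m`. For
even `n = 2m` the bound is `a_m²`; for odd `n = 2m+1` it is `4(2m+1)² a_m²/((4m+3)² + 1) ≤ a_m²`. Hence

  **`sin θ · P_n(cos θ)² ≤ a_{⌊n/2⌋}²`** for every `n` and `θ ∈ (0, π)`  (`sin_mul_sq_legP_cos_le_binomHalf`),

and Wallis' product (`a_m² · (2m+1) · W_m = 1`, `W_m ≥ (2m+1)/(2m+2) · π/2`; Mathlib's `Real.Wallis.le_W`) gives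
**`a_m² ≤ 1/(πm)`** (`binomHalf_sq_le`), so

  **`sin θ · P_n(cos θ)² ≤ 2/(πn)`** for even `n ≥ 2`  and  **`≤ 2/(π(n − 1))`** for odd `n ≥ 3`
  (`bernstein_even`, `bernstein_odd`), i.e. **`√(sin θ) |P_n(cos θ)| ≤ √(2/(πn))`** for even `n`
  (`sqrt_sin_mul_abs_legP_cos_le`) — Bernstein's inequality with its sharp constant at the even degrees, and the
  constant `2/(π(n−1))` at the odd degrees. In the variable `x`: `√(1 − x²) P_n(x)² ≤ a_{⌊n/2⌋}²` on `(−1, 1)`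
  (`sqrt_one_sub_sq_mul_sq_legP_le_binomHalf`). Nothing is claimed about (N).

Blind lane: Mathlib + the HodgeRepro2 prefix only; no sorry; axioms ⊆ {propext, Classical.choice,
Quot.sound}.
-/

namespace Summit.Ventures.HodgeRepro2.T5SU11LegendreBernstein

open scoped Real
open T5SU11SphericalLegendreAll T5SU11LegendreIdentities T5SU11LegendreHeine T5SU11LegendreAtZero
  T5SU11LegendreCentralBinomial T5SU11LegendreSoninPolya

/-! ### The derivative at the origin -/

/-- **`P_n′(0) = −(n + 1) P_{n+1}(0)`** (from `x P′_{n+1} − P′_n = (n + 1) P_{n+1}` at `x = 0`). -/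
theorem legQ_zero (n : ℕ) : legQ n 0 = -((n : ℝ) + 1) * legP (n + 1) 0 := by
  have h := mul_legQ_succ_sub_legQ n 0
  linear_combination -h

/-- `P_{2m}′(0) = 0`. -/
theorem legQ_zero_even (m : ℕ) : legQ (2 * m) 0 = 0 := by
  rw [legQ_zero, legP_zero_odd]
  ring

/-- `P_{2m+1}′(0)² = (2m + 1)² a_m²`. -/
theorem sq_legQ_zero_odd (m : ℕ) : legQ (2 * m + 1) 0 ^ 2 = (2 * (m : ℝ) + 1) ^ 2 * binomHalf m ^ 2 := by
  rw [legQ_zero, show 2 * m + 1 + 1 = 2 * (m + 1) by ring, legP_zero_even]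
  have h := binomHalf_succ m
  push_cast
  have e : (2 * (m : ℝ) + 2) * binomHalf (m + 1) = (2 * (m : ℝ) + 1) * binomHalf m := by
    linear_combination 2 * h
  calc (-((2 : ℝ) * m + 1 + 1) * ((-1) ^ (m + 1) * binomHalf (m + 1))) ^ 2
      = ((2 * (m : ℝ) + 2) * binomHalf (m + 1)) ^ 2 * ((-1) ^ (m + 1)) ^ 2 := by ring
    _ = ((2 * (m : ℝ) + 1) * binomHalf m) ^ 2 * 1 := by
        rw [e, ← pow_mul, mul_comm (m + 1) 2, pow_mul]
        simp only [neg_one_sq, one_pow]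
    _ = (2 * (m : ℝ) + 1) ^ 2 * binomHalf m ^ 2 := by ring

/-! ### The Sonin–Pólya bound evaluated -/

/-- Even degree: the Sonin–Pólya constant is `a_m²`. -/
theorem sonin_bound_even (m : ℕ) :
    legP (2 * m) 0 ^ 2 + 4 * legQ (2 * m) 0 ^ 2 / ((2 * ((2 * m : ℕ) : ℝ) + 1) ^ 2 + 1) = binomHalf m ^ 2 := by
  rw [legQ_zero_even, legP_zero_even, mul_pow, ← pow_mul, mul_comm m 2, pow_mul]
  simp only [neg_one_sq, one_pow, one_mul]
  ring

/-- Odd degree: the Sonin–Pólya constant is `4(2m+1)² a_m²/((4m+3)² + 1) ≤ a_m²`. -/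
theorem sonin_bound_odd (m : ℕ) :
    legP (2 * m + 1) 0 ^ 2 + 4 * legQ (2 * m + 1) 0 ^ 2 / ((2 * ((2 * m + 1 : ℕ) : ℝ) + 1) ^ 2 + 1)
      ≤ binomHalf m ^ 2 := by
  rw [legP_zero_odd, sq_legQ_zero_odd]
  push_cast
  have hpos : 0 < (2 * (2 * (m : ℝ) + 1) + 1) ^ 2 + 1 := by positivity
  have ha : 0 ≤ binomHalf m ^ 2 := sq_nonneg _
  rw [zero_pow two_ne_zero, zero_add, div_le_iff₀ hpos]
  have hm : (0 : ℝ) ≤ m := Nat.cast_nonneg m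
  nlinarith [mul_nonneg ha hm, mul_nonneg ha (mul_nonneg hm hm)]

/-- **`sin θ · P_n(cos θ)² ≤ a_{⌊n/2⌋}²`** for every `n` and `θ ∈ (0, π)`. -/
theorem sin_mul_sq_legP_cos_le_binomHalf (n : ℕ) {θ : ℝ} (h0 : 0 < θ) (hπ : θ < π) :
    Real.sin θ * legP n (Real.cos θ) ^ 2 ≤ binomHalf (n / 2) ^ 2 := by
  have h := sin_mul_sq_legP_cos_le n h0 hπ
  obtain ⟨m, hm | hm⟩ := Nat.even_or_odd' n
  · subst hm
    rw [show 2 * m / 2 = m by omega]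
    rw [sonin_bound_even] at h
    exact h
  · subst hm
    rw [show (2 * m + 1) / 2 = m by omega]
    exact le_trans h (sonin_bound_odd m)

/-- In the variable `x`: `√(1 − x²) · P_n(x)² ≤ a_{⌊n/2⌋}²` on `(−1, 1)`. -/
theorem sqrt_one_sub_sq_mul_sq_legP_le_binomHalf (n : ℕ) {x : ℝ} (hx1 : -1 < x) (hx2 : x < 1) :
    Real.sqrt (1 - x ^ 2) * legP n x ^ 2 ≤ binomHalf (n / 2) ^ 2 := by
  have h := sin_mul_sq_legP_cos_le_binomHalf n (θ := Real.arccos x) (Real.arccos_pos.mpr hx2)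
    (Real.arccos_lt_pi.mpr hx1)
  rwa [Real.sin_arccos, Real.cos_arccos hx1.le hx2.le] at h

/-! ### Wallis: `a_m² ≤ 1/(πm)` -/

/-- **`a_m² · (2m + 1) · W_m = 1`**: the central binomial coefficient against Wallis' partial product. -/
theorem binomHalf_sq_mul_wallis (m : ℕ) : binomHalf m ^ 2 * ((2 * (m : ℝ) + 1) * Real.Wallis.W m) = 1 := by
  rw [Real.Wallis.W_eq_factorial_ratio, binomHalf_eq_factorial]
  have h1 : ((2 * m).factorial : ℝ) ≠ 0 := by positivity
  have h2 : (m.factorial : ℝ) ≠ 0 := by positivity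
  have h3 : (2 * (m : ℝ) + 1) ≠ 0 := by positivity
  have e : (2 : ℝ) ^ (4 * m) = 4 ^ m * 4 ^ m := by
    rw [show 4 * m = 2 * m + 2 * m by ring, pow_add, pow_mul]
    norm_num
  rw [e]
  field_simp

/-- **`a_m² ≤ 1/(πm)`** for `m ≥ 1` (from `W_m ≥ (2m+1)/(2m+2) · π/2`). -/
theorem binomHalf_sq_le {m : ℕ} (hm : 1 ≤ m) : binomHalf m ^ 2 ≤ 1 / (π * m) := by
  have hπ := Real.pi_pos
  have hm' : (1 : ℝ) ≤ m := by exact_mod_cast hm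
  have hW := Real.Wallis.le_W m
  have hWpos := Real.Wallis.W_pos m
  have hid := binomHalf_sq_mul_wallis m
  have hden : 0 < (2 * (m : ℝ) + 1) * Real.Wallis.W m := by positivity
  have ha : binomHalf m ^ 2 = 1 / ((2 * (m : ℝ) + 1) * Real.Wallis.W m) := by
    rw [eq_div_iff hden.ne']
    exact hid
  rw [ha]
  have hlow : π * m ≤ (2 * (m : ℝ) + 1) * Real.Wallis.W m := by
    calc π * m ≤ (2 * (m : ℝ) + 1) * ((2 * (m : ℝ) + 1) / (2 * m + 2) * (π / 2)) := by
          rw [← sub_nonneg]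
          have e : (2 * (m : ℝ) + 1) * ((2 * (m : ℝ) + 1) / (2 * m + 2) * (π / 2)) - π * m
              = π / (2 * (2 * (m : ℝ) + 2)) := by
            field_simp
            ring
          rw [e]
          positivity
      _ ≤ (2 * (m : ℝ) + 1) * Real.Wallis.W m := mul_le_mul_of_nonneg_left hW (by positivity)
  exact one_div_le_one_div_of_le (by positivity) hlow

/-! ### Bernstein's inequality -/

/-- **BERNSTEIN'S INEQUALITY, even degree `n = 2m ≥ 2`**: `sin θ · P_n(cos θ)² ≤ 2/(πn)`. -/
theorem bernstein_even {m : ℕ} (hm : 1 ≤ m) {θ : ℝ} (h0 : 0 < θ) (hπ : θ < π) :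
    Real.sin θ * legP (2 * m) (Real.cos θ) ^ 2 ≤ 2 / (π * ((2 * m : ℕ) : ℝ)) := by
  have h := sin_mul_sq_legP_cos_le_binomHalf (2 * m) h0 hπ
  rw [show 2 * m / 2 = m by omega] at h
  have hπ0 := Real.pi_pos
  have hm' : (1 : ℝ) ≤ m := by exact_mod_cast hm
  have e : 2 / (π * ((2 * m : ℕ) : ℝ)) = 1 / (π * m) := by
    push_cast
    field_simp
  rw [e]
  exact le_trans h (binomHalf_sq_le hm)

/-- **BERNSTEIN'S INEQUALITY, odd degree `n = 2m + 1 ≥ 3`**: `sin θ · P_n(cos θ)² ≤ 2/(π(n − 1))`. -/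
theorem bernstein_odd {m : ℕ} (hm : 1 ≤ m) {θ : ℝ} (h0 : 0 < θ) (hπ : θ < π) :
    Real.sin θ * legP (2 * m + 1) (Real.cos θ) ^ 2 ≤ 2 / (π * (((2 * m + 1 : ℕ) : ℝ) - 1)) := by
  have h := sin_mul_sq_legP_cos_le_binomHalf (2 * m + 1) h0 hπ
  rw [show (2 * m + 1) / 2 = m by omega] at h
  have hπ0 := Real.pi_pos
  have hm' : (1 : ℝ) ≤ m := by exact_mod_cast hm
  have e : 2 / (π * (((2 * m + 1 : ℕ) : ℝ) - 1)) = 1 / (π * m) := by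
    push_cast
    field_simp
    ring
  rw [e]
  exact le_trans h (binomHalf_sq_le hm)

/-- **Bernstein's inequality, all degrees `n ≥ 2`**: `sin θ · P_n(cos θ)² ≤ 1/(π ⌊n/2⌋)`. -/
theorem bernstein {n : ℕ} (hn : 2 ≤ n) {θ : ℝ} (h0 : 0 < θ) (hπ : θ < π) :
    Real.sin θ * legP n (Real.cos θ) ^ 2 ≤ 1 / (π * ((n / 2 : ℕ) : ℝ)) :=
  le_trans (sin_mul_sq_legP_cos_le_binomHalf n h0 hπ) (binomHalf_sq_le (by omega))

/-- **`√(sin θ) |P_n(cos θ)| ≤ √(2/(πn))`** for even `n ≥ 2`: Bernstein's inequality in its classical form. -/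
theorem sqrt_sin_mul_abs_legP_cos_le {m : ℕ} (hm : 1 ≤ m) {θ : ℝ} (h0 : 0 < θ) (hπ : θ < π) :
    Real.sqrt (Real.sin θ) * |legP (2 * m) (Real.cos θ)| ≤ Real.sqrt (2 / (π * ((2 * m : ℕ) : ℝ))) := by
  have hs : 0 ≤ Real.sin θ := Real.sin_nonneg_of_nonneg_of_le_pi h0.le hπ.le
  rw [← Real.sqrt_sq_eq_abs, ← Real.sqrt_mul hs]
  exact Real.sqrt_le_sqrt (bernstein_even hm h0 hπ)

end Summit.Ventures.HodgeRepro2.T5SU11LegendreBernstein
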